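import Summits.QuantumFields.BalabanUV.T4Continuum.Support.NE3CovariantCalculus
import HarnessLib

/-!
# NE7CovariantHodgeBond — THE COVARIANT LATTICE HODGE IDENTITY FOR A SITE-FRAMED BOND FIELD, POINTWISE AND EXACT:
# `Σ_μ (∇_μ + ∇_μ^†) A_ν = −Σ_μ ∇_μ^†(dA)_{μν} + ∇_ν(div A) − Σ_μ [∇_μ^†, ∇_ν] A_μ`, the commutator being conjugation by a plaquette variable
# (`NE3CovariantCalculus.norm_comm_le`: `≤ 2a‖A‖`) — hence `‖Δ_V A_ν‖ ≤ J + P + 2d·a·U` from the curl co-differential `J`, the divergence gradient `P`, the sup `U`; file 48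

Cell `pub-balaban`, rung (B)+1 sub-cell t4, lineage `b2b-balaban-t4-ne7-p1` (CRUX PROVER NE7 #1 = OWNER of row NE7), generation 79; memo
`t4/b2b-balaban-t4-ne7-p1-g78/BUMP-CLASS-FLAT.md` §7 POINTER (letter `α₁^Z` of road (B)).  File F117, the curved twin of lineage #2's (156) §1
`NE7LatticeHodgeGradient.laplacian_eq_sum_dCurl_add_dDiv` (flat: `−Δ = δd + dδ` exactly, differences commute), over the NE3 swarm's leaf kit `NE3CovariantCalculus`
(`cD V μ f x = Ad_{V(x,μ)} f(x+e_μ) − f(x)`, `cDstar V μ g x = Ad_{V(x−e_μ,μ)}⁻¹ g(x−e_μ) − g(x)`, `cdiv`, `cDstar_cD_sub_cD_cDstar`, `norm_comm_le`).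
WHY.  F116 `NE7CovariantInteriorGradient.norm_cD_le_of_covLap` bounds the covariant gradient of a site-framed field by its sup and the sup of its ROUGH covariant
Laplacian `Σ_μ (∇_μ + ∇_μ^†)`.  What a Landau-type representative carries is not the rough Laplacian but the HODGE data: the co-differential of its covariant curl
(the linearised field strength — docked to the plaquette deviations of `W·e^{Z}` and `W` in F118) and the gradient of its covariant divergence (the Landau reaction,
exported by E′).  At a curved background the two Laplacians differ by the curvature commutator `[∇_μ^†, ∇_ν]` = `Ad_{V(z,μ)⁻¹}(1 − Ad_{V(∂p)})(…)` — zeroth order in `A`,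
first order in the plaquette radius `a`.  THIS FILE is that bookkeeping, pointwise (sup currency), for ANY configuration `V` (the identity) ∕ unitary small-field `V`
(the bound).
WHAT ([folklore]; 0 def, 0 sorry).  §1 `cDstar_sub'`, `cD_add_cDstar_eq` (`(∇_μ + ∇_μ^†)f = −∇_μ^†∇_μ f`), **`covLap_eq_hodge`** (the displayed identity, every `V`,
`A`, `x`, `ν`).  §2 `hol_plaqWord_self` (the degenerate plaquette `(z; μ, μ)` has holonomy `1`), **`norm_covLap_le_hodge`**: unitary `V`, `SmallField V a`, `‖A‖ ≤ U`,
`‖Σ_μ ∇_μ^†(dA)_{μν}(x)‖ ≤ J`, `‖∇_ν(div A)(x)‖ ≤ P` ⟹ `‖Σ_μ (∇_μ + ∇_μ^†) A_ν (x)‖ ≤ J + P + 2d·a·U`.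
HONEST FRAMING (page 1): elementary covariant lattice calculus at ONE configuration; nothing of Bałaban's asserted; no Landau gauge, no minimiser here; `α₁^Z` NOT yet
discharged (F118–F120); (APE) on curved data NOT proved; NOT ONE-STEP, NOT NE7; spine 0∕9; finite T⁴ rung (B)+1 — NOT infinite volume, NOT mass gap, NOT `BetaPertH`,
NOT Clay.  Continuum YM on T⁴ ⇐ BetaPertH ∧ nine spine estimates (0/9 proved); BetaPertH ⇐ (D1) ∧ (D4) ∧ CAP+tail; G-an2-4 gates asym, D1 and NE2/3/4.
-/

set_option autoImplicit false

open scoped BigOperators Matrix Matrix.Norms.L2Operator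
open NormedSpace Finset

namespace Summit.QuantumFields.BalabanUV.T4Continuum.NE7CovariantHodgeBond

open Literature.MathematicalPhysics.QuantumFieldTheory.Balaban1983to89
open B7Prop1Explicit B7Prop2Explicit
open T4AveragingDeficitWall (Ad IsUnitaryCfg SmallField)
open T4AveragingDeficitNonAbelian (Ad_mul Ad_sub)
open AveragingDeficitTransport (norm_Ad_of_unitary)
open AveragingDeficitNearIdentity (Ad_one Ad_add Ad_sum Ad_neg)
open AveragingDeficitCovGrad (hol_plaqWord_units)
open NE3CovariantCalculus (cD cDstar cdiv cdiv_eq_neg_sum_cDstar cDstar_cD_sub_cD_cDstar norm_comm_le)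

noncomputable section

variable {d : ℕ} {n : Type*} [Fintype n] [DecidableEq n]

/-! ## §1 The identity -/

/-- `∇_μ^†` is additive: `∇_μ^†(g − h) = ∇_μ^† g − ∇_μ^† h`. [folklore] -/
theorem cDstar_sub' (V : Site d → Fin d → (Matrix n n ℂ)ˣ) (μ : Fin d) (g h : Site d → Matrix n n ℂ) (x : Site d) :
    cDstar V μ (fun y => g y - h y) x = cDstar V μ g x - cDstar V μ h x := by
  simp only [cDstar, Ad_sub]
  abel

/-- `∇_ν` is additive: `∇_ν(g − h) = ∇_ν g − ∇_ν h`. [folklore] -/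
theorem cD_sub' (V : Site d → Fin d → (Matrix n n ℂ)ˣ) (ν : Fin d) (g h : Site d → Matrix n n ℂ) (x : Site d) :
    cD V ν (fun y => g y - h y) x = cD V ν g x - cD V ν h x := by
  simp only [cD, Ad_sub]
  abel

/-- `∇_ν(−Σ_μ g_μ) = −Σ_μ ∇_ν g_μ`. [folklore] -/
theorem cD_neg_sum (V : Site d → Fin d → (Matrix n n ℂ)ˣ) (ν : Fin d) (g : Fin d → Site d → Matrix n n ℂ) (x : Site d) :
    cD V ν (fun y => -∑ μ, g μ y) x = -∑ μ, cD V ν (g μ) x := by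
  simp only [cD, Ad_neg, Ad_sum, Finset.sum_sub_distrib]
  abel

/-- **ONE DIRECTION**: `(∇_μ + ∇_μ^†) f (x) = −∇_μ^†(∇_μ f)(x)` (`Ad_{V(b)⁻¹}Ad_{V(b)} = 1`). [folklore] -/
theorem cD_add_cDstar_eq (V : Site d → Fin d → (Matrix n n ℂ)ˣ) (μ : Fin d) (f : Site d → Matrix n n ℂ) (x : Site d) :
    cD V μ f x + cDstar V μ f x = -cDstar V μ (cD V μ f) x := by
  simp only [cD, cDstar, Ad_sub, ← Ad_mul, inv_mul_cancel, Ad_one, sub_add_cancel]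
  abel

/-- **THE COVARIANT LATTICE HODGE IDENTITY FOR A SITE-FRAMED BOND FIELD** (every configuration `V`, every `A : ℤᵈ → (Fin d → 𝕄)`, site `x`, component `ν`):
`Σ_μ (∇_μ + ∇_μ^†) A_ν (x) = −Σ_μ ∇_μ^†(∇_μ A_ν − ∇_ν A_μ)(x) + ∇_ν(cdiv V A)(x) − Σ_μ (∇_μ^†∇_ν A_μ − ∇_ν∇_μ^† A_μ)(x)` — the lattice form of
`∇^*∇ = δ_V d_V + d_V δ_V + curvature` on 1-forms; at a flat `V` the last sum vanishes ((156) §1). [folklore] -/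
theorem covLap_eq_hodge (V : Site d → Fin d → (Matrix n n ℂ)ˣ) (A : Site d → Fin d → Matrix n n ℂ) (x : Site d) (ν : Fin d) :
    ∑ μ, (cD V μ (fun y => A y ν) x + cDstar V μ (fun y => A y ν) x)
      = -∑ μ, cDstar V μ (fun y => cD V μ (fun z => A z ν) y - cD V ν (fun z => A z μ) y) x
        + cD V ν (cdiv V A) x
        - ∑ μ, (cDstar V μ (cD V ν (fun z => A z μ)) x - cD V ν (cDstar V μ (fun z => A z μ)) x) := by
  have hdiv : cD V ν (cdiv V A) x = -∑ μ, cD V ν (cDstar V μ (fun z => A z μ)) x := by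
    have h : cdiv V A = fun y => -∑ μ, cDstar V μ (fun z => A z μ) y := by
      funext y; exact cdiv_eq_neg_sum_cDstar V A y
    rw [h, cD_neg_sum]
  rw [hdiv]
  simp only [cDstar_sub', cD_add_cDstar_eq, Finset.sum_sub_distrib, Finset.sum_neg_distrib]
  abel

/-! ## §2 The pointwise bound at a unitary small-field background -/

/-- The degenerate plaquette `(z; μ, μ)` has holonomy `1`. [folklore] -/
theorem hol_plaqWord_self (V : Site d → Fin d → (Matrix n n ℂ)ˣ) (z : Site d) (μ : Fin d) : hol V z (plaqWord μ μ) = 1 := by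
  rw [hol_plaqWord_units]
  group

/-- Under `SmallField V a` (`a ≥ 0`) EVERY plaquette word, degenerate ones included, is within `a` of `1`. [folklore] -/
theorem norm_hol_plaqWord_sub_one_le {V : Site d → Fin d → (Matrix n n ℂ)ˣ} {a : ℝ} (ha : 0 ≤ a) (hVa : SmallField V a)
    (z : Site d) (μ ν : Fin d) : ‖((hol V z (plaqWord μ ν) : (Matrix n n ℂ)ˣ) : Matrix n n ℂ) - 1‖ ≤ a := by
  by_cases h : μ = ν
  · subst h; rw [hol_plaqWord_self, Units.val_one, sub_self, norm_zero]; exact ha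
  · exact hVa z μ ν h

/-- **THE ROUGH COVARIANT LAPLACIAN FROM THE HODGE DATA, POINTWISE**: for unitary `V` with `SmallField V a`, a site-framed `A` with `‖A‖ ≤ U` everywhere, and at the
site `x` and component `ν` the bounds `‖Σ_μ ∇_μ^†(∇_μ A_ν − ∇_ν A_μ)(x)‖ ≤ J` (co-differential of the covariant curl) and `‖∇_ν(cdiv V A)(x)‖ ≤ P` (gradient of the
covariant divergence): `‖Σ_μ (∇_μ + ∇_μ^†) A_ν (x)‖ ≤ J + P + 2d·a·U`. [folklore] -/
theorem norm_covLap_le_hodge [Nonempty n] {V : Site d → Fin d → (Matrix n n ℂ)ˣ} (hV : IsUnitaryCfg V) {a : ℝ} (ha : 0 ≤ a) (hVa : SmallField V a)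
    (A : Site d → Fin d → Matrix n n ℂ) {U : ℝ} (hU : ∀ y κ, ‖A y κ‖ ≤ U) (x : Site d) (ν : Fin d) {J P : ℝ}
    (hJ : ‖∑ μ, cDstar V μ (fun y => cD V μ (fun z => A z ν) y - cD V ν (fun z => A z μ) y) x‖ ≤ J)
    (hP : ‖cD V ν (cdiv V A) x‖ ≤ P) :
    ‖∑ μ, (cD V μ (fun y => A y ν) x + cDstar V μ (fun y => A y ν) x)‖ ≤ J + P + 2 * d * a * U := by
  rw [covLap_eq_hodge]
  have hcomm : ‖∑ μ, (cDstar V μ (cD V ν (fun z => A z μ)) x - cD V ν (cDstar V μ (fun z => A z μ)) x)‖ ≤ 2 * d * a * U := by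
    refine (norm_sum_le _ _).trans ?_
    have hterm : ∀ μ : Fin d, ‖cDstar V μ (cD V ν (fun z => A z μ)) x - cD V ν (cDstar V μ (fun z => A z μ)) x‖ ≤ 2 * a * U := by
      intro μ
      have hx : x = (x - e μ) + e μ := (sub_add_cancel x (e μ)).symm
      have h := norm_comm_le hV μ ν (fun z => A z μ) (x - e μ) (norm_hol_plaqWord_sub_one_le ha hVa (x - e μ) μ ν)
      rw [← hx] at h
      exact h.trans (mul_le_mul_of_nonneg_left (hU _ _) (by positivity))
    calc ∑ μ, ‖cDstar V μ (cD V ν (fun z => A z μ)) x - cD V ν (cDstar V μ (fun z => A z μ)) x‖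
        ≤ ∑ _μ : Fin d, 2 * a * U := Finset.sum_le_sum fun μ _ => hterm μ
      _ = 2 * d * a * U := by rw [Finset.sum_const, Finset.card_univ, Fintype.card_fin, nsmul_eq_mul]; ring
  calc _ ≤ ‖-∑ μ, cDstar V μ (fun y => cD V μ (fun z => A z ν) y - cD V ν (fun z => A z μ) y) x + cD V ν (cdiv V A) x‖
          + ‖∑ μ, (cDstar V μ (cD V ν (fun z => A z μ)) x - cD V ν (cDstar V μ (fun z => A z μ)) x)‖ := norm_sub_le _ _
    _ ≤ (J + P) + 2 * d * a * U := by
        refine add_le_add ((norm_add_le _ _).trans (add_le_add ?_ hP)) hcomm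
        rw [norm_neg]; exact hJ

end

end Summit.QuantumFields.BalabanUV.T4Continuum.NE7CovariantHodgeBond
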